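import Mathlib
import Literature.MathematicalPhysics.QuantumFieldTheory.Balaban1983to89.B5Prop11Plancherel

/-!
# Road «FP», row IR-5′ (c′) — FILE F3a: the ALGEBRA of the lattice supersolution `1∕(|a|² + R²)` (dimension
# `D ≥ 4`) and the centred representatives of torus neighbours

Cell `pub-balaban`, β sub-cell, binder row D1, road «FP» (owner `b2b-balaban-beta-d1-p3`, «GO» journal
2026-08-21T10:09Z), lane (U2) IR-5′ (unit `b2b-balaban-beta-d1-formalise-leaf-05`, gen 17).  Part of the m-UNIFORM
SUP LETTER of the perfect ff block (`FF-SUP-PLAN.md`; F1 `FP/CovarianceLoewnerSandwich`, F2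
`FP/TorusLaplaceComparison`).  This file holds the two [folklore] ingredients of the explicit supersolution
assembled in F3b `FP/TorusSupersolution`:
* §1 REAL ALGEBRA.  For `s ≥ 4`, `a² ≤ s − 4`:
  `2∕s − 1∕(s+1+2a) − 1∕(s+1−2a) ≥ 2∕(s(s+1)) − 8a²∕(s(s−1)²)` (`term_lower`: the exact value is
  `(2s+2−8a²)∕(s·q)`, `q = (s+1)² − 4a² ∈ [(s−1)², (s+1)²]`); summing over `ν` with `Σa_ν² = s − R²`, `D ≥ 4`,
  `R² ≥ D + 2`, `R² ≥ 4`: `Σ_ν (…) ≥ 4R²∕(s+1)³` (**`sum_lower`**; the numerator inequality is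
  `(2D−8)s² + (4R²−4D−8)s + 2D + 8R² ≥ 0` — this is where `D ≥ 4` enters), and `≥ 4∕((D+2)³R⁴)` when
  `|a_ν| ≤ R` for all `ν` (**`sum_lower_box`**).  This is the `ℤ^D` stencil `Σ_ν (2φ(a) − φ(a+e_ν) − φ(a−e_ν))` of
  `φ(a) = 1∕(|a|² + R²)`, `s = |a|² + R²`.
* §2 TORUS REPRESENTATIVES on `T = Π_μ ℤ∕P_μ` (`x̃_μ := ZMod.valMinAbs (x_μ)`): coordinates of `x ± e_ν`
  (`add_unitVec_self∕_ne`, `sub_unitVec_self∕_ne`); away from the seam (`2|z̃| + 2 < P`) `valMinAbs (z ± 1) =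
  z̃ ± 1` (`valMinAbs_add_one`, `valMinAbs_sub_one`, via `ZMod.valMinAbs_spec`); ALWAYS (`P ≥ 3`)
  `|valMinAbs (z ± 1)| ≥ |z̃| − 1` (`abs_valMinAbs_add_one_ge`, `…sub…`, via `ZMod.natAbs_valMinAbs_add_le`),
  `sq_ge_of_abs_ge`; the squared-representative sums of the neighbours: exact (`sum_sq_add_unitVec`,
  `sum_sq_sub_unitVec`) and bounded below by `Σ_μ x̃_μ² − 2|x̃_ν|` (`sum_sq_add_unitVec_ge`, `…sub…`).

HONEST SCOPE: elementary; no B5 statement used; 0∕4 row-D1 binders; NOT hfar, NOT hRb, NOT (ASYMP), NOT D1, NOT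
BetaPertH, NOT continuum, NOT Clay.  HONEST DEPENDENCY: continuum YM on T⁴ ⇐ BetaPertH ∧ nine spine estimates (0/9
proved); BetaPertH ⇐ (D1) ∧ (D4) ∧ CAP+tail; G-an2-4 gates asym, D1 and NE2/3/4.
-/

noncomputable section

open scoped BigOperators

namespace Summit.QuantumFields.BalabanUV.Beta.FP.TorusSupersolutionAlgebra

open Literature.MathematicalPhysics.QuantumFieldTheory.Balaban1983to89.B5Prop11Plancherel

/-! ## §1 Real algebra -/

section Algebra

/-- one direction of the stencil of `1∕s`: `2∕s − 1∕(s+1+2a) − 1∕(s+1−2a) ≥ 2∕(s(s+1)) − 8a²∕(s(s−1)²)` for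
`s ≥ 4`, `a² ≤ s − 4`. [folklore] -/
theorem term_lower {s a : ℝ} (hs : 4 ≤ s) (ha : a ^ 2 ≤ s - 4) :
    2 / (s * (s + 1)) - 8 * a ^ 2 / (s * (s - 1) ^ 2)
      ≤ 2 / s - 1 / (s + 1 + 2 * a) - 1 / (s + 1 - 2 * a) := by
  have hs0 : 0 < s := by linarith
  have hsm1 : 0 < s - 1 := by linarith
  have habs : |2 * a| ≤ s - 1 := by
    rw [← Real.sqrt_sq hsm1.le, ← Real.sqrt_sq_eq_abs]
    exact Real.sqrt_le_sqrt (by nlinarith)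
  have hp : 0 < s + 1 + 2 * a := by linarith [neg_abs_le (2 * a)]
  have hm : 0 < s + 1 - 2 * a := by linarith [le_abs_self (2 * a)]
  set q := (s + 1) ^ 2 - 4 * a ^ 2 with hq
  have hq_eq : q = (s + 1 + 2 * a) * (s + 1 - 2 * a) := by rw [hq]; ring
  have hq_pos : 0 < q := by rw [hq_eq]; positivity
  have hq_lo : (s - 1) ^ 2 ≤ q := by rw [hq]; nlinarith
  have e : 2 / s - 1 / (s + 1 + 2 * a) - 1 / (s + 1 - 2 * a) = (2 * s + 2) / (s * q) - 8 * a ^ 2 / (s * q) := by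
    rw [hq_eq]
    field_simp
    ring
  rw [e]
  have h1 : 2 / (s * (s + 1)) ≤ (2 * s + 2) / (s * q) := by
    rw [div_le_div_iff₀ (by positivity) (by positivity)]
    nlinarith
  have h2 : 8 * a ^ 2 / (s * q) ≤ 8 * a ^ 2 / (s * (s - 1) ^ 2) := by
    apply div_le_div_of_nonneg_left (by positivity) (by positivity)
    exact mul_le_mul_of_nonneg_left hq_lo hs0.le
  linarith

/-- **the `ℤ^D` stencil of `1∕(|a|² + R²)` is bounded below by `4R²∕(s+1)³`** (`s = |a|² + R²`), for `D ≥ 4`,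
`R² ≥ D + 2`, `R² ≥ 4` — stated for real `a`. [folklore] -/
theorem sum_lower {D : ℕ} (hD : 4 ≤ D) (a : Fin D → ℝ) {R : ℝ} (hR : (D : ℝ) + 2 ≤ R ^ 2) (hR4 : 4 ≤ R ^ 2) :
    4 * R ^ 2 / ((∑ μ, a μ ^ 2 + R ^ 2) + 1) ^ 3
      ≤ ∑ ν, (2 / (∑ μ, a μ ^ 2 + R ^ 2) - 1 / ((∑ μ, a μ ^ 2 + R ^ 2) + 1 + 2 * a ν)
          - 1 / ((∑ μ, a μ ^ 2 + R ^ 2) + 1 - 2 * a ν)) := by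
  set s := ∑ μ, a μ ^ 2 + R ^ 2 with hs
  have hsum_nn : 0 ≤ ∑ μ, a μ ^ 2 := Finset.sum_nonneg fun μ _ => sq_nonneg _
  have hs4 : 4 ≤ s := by rw [hs]; linarith
  have hs0 : 0 < s := by linarith
  have haν : ∀ ν, a ν ^ 2 ≤ s - 4 := by
    intro ν
    have : a ν ^ 2 ≤ ∑ μ, a μ ^ 2 := Finset.single_le_sum (fun μ _ => sq_nonneg (a μ)) (Finset.mem_univ ν)
    rw [hs]; linarith
  have hstep : ∑ ν, (2 / (s * (s + 1)) - 8 * a ν ^ 2 / (s * (s - 1) ^ 2))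
      ≤ ∑ ν, (2 / s - 1 / (s + 1 + 2 * a ν) - 1 / (s + 1 - 2 * a ν)) :=
    Finset.sum_le_sum fun ν _ => term_lower hs4 (haν ν)
  refine le_trans ?_ hstep
  rw [Finset.sum_sub_distrib, Finset.sum_const, Finset.card_univ, Fintype.card_fin, nsmul_eq_mul,
    ← Finset.sum_div, ← Finset.mul_sum]
  have hsum_eq : ∑ ν, a ν ^ 2 = s - R ^ 2 := by rw [hs]; ring
  rw [hsum_eq]
  have hD' : (4 : ℝ) ≤ D := by exact_mod_cast hD
  have hsm1 : 0 < s - 1 := by linarith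
  have key : 0 ≤ (2 * (D : ℝ) - 8) * s ^ 2 + (4 * R ^ 2 - 4 * D - 8) * s + 2 * D + 8 * R ^ 2 := by
    have h1 : 0 ≤ (2 * (D : ℝ) - 8) * s ^ 2 := mul_nonneg (by linarith) (sq_nonneg _)
    have h2 : 0 ≤ (4 * R ^ 2 - 4 * D - 8) * s := mul_nonneg (by linarith) hs0.le
    positivity
  have lhs_le : 4 * R ^ 2 / (s + 1) ^ 3 ≤ 4 * R ^ 2 / ((s + 1) * (s - 1) ^ 2) := by
    apply div_le_div_of_nonneg_left (by positivity) (by positivity)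
    nlinarith
  refine lhs_le.trans ?_
  set X := s * ((s + 1) * (s - 1) ^ 2) with hX
  have hX0 : 0 < X := by positivity
  have hne1 : (s + 1) * (s - 1) ^ 2 ≠ 0 := by positivity
  have hne2 : s * (s + 1) ≠ 0 := by positivity
  have hne3 : s * (s - 1) ^ 2 ≠ 0 := by positivity
  have eL : 4 * R ^ 2 / ((s + 1) * (s - 1) ^ 2) = 4 * R ^ 2 * s / X := by
    rw [div_eq_div_iff hne1 hX0.ne']; ring
  have eD : (D : ℝ) * (2 / (s * (s + 1))) = 2 * D * (s - 1) ^ 2 / X := by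
    rw [mul_div_assoc', div_eq_div_iff hne2 hX0.ne']; ring
  have e8 : 8 * (s - R ^ 2) / (s * (s - 1) ^ 2) = 8 * (s - R ^ 2) * (s + 1) / X := by
    rw [div_eq_div_iff hne3 hX0.ne']; ring
  rw [eL, eD, e8, ← sub_div]
  apply div_le_div_of_nonneg_right _ hX0.le
  have e : 2 * (D : ℝ) * (s - 1) ^ 2 - 8 * (s - R ^ 2) * (s + 1) - 4 * R ^ 2 * s
      = (2 * (D : ℝ) - 8) * s ^ 2 + (4 * R ^ 2 - 4 * D - 8) * s + 2 * D + 8 * R ^ 2 := by ring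
  linarith [key, e]

/-- on the box `|a_ν| ≤ R` the lower bound becomes `4∕((D+2)³R⁴)`. [folklore] -/
theorem sum_lower_box {D : ℕ} (hD : 4 ≤ D) (a : Fin D → ℝ) {R : ℝ} (hR : (D : ℝ) + 2 ≤ R ^ 2) (hR4 : 4 ≤ R ^ 2)
    (hbox : ∀ ν, |a ν| ≤ R) :
    4 / (((D : ℝ) + 2) ^ 3 * R ^ 4)
      ≤ ∑ ν, (2 / (∑ μ, a μ ^ 2 + R ^ 2) - 1 / ((∑ μ, a μ ^ 2 + R ^ 2) + 1 + 2 * a ν)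
          - 1 / ((∑ μ, a μ ^ 2 + R ^ 2) + 1 - 2 * a ν)) := by
  refine le_trans ?_ (sum_lower hD a hR hR4)
  have hR0 : 0 < R := by nlinarith [hbox ⟨0, by omega⟩, abs_nonneg (a ⟨0, by omega⟩)]
  have hsum : ∑ μ, a μ ^ 2 ≤ (D : ℝ) * R ^ 2 := by
    calc ∑ μ, a μ ^ 2 ≤ ∑ _μ : Fin D, R ^ 2 := Finset.sum_le_sum fun μ _ => by
            have := hbox μ; rw [← sq_abs]; exact pow_le_pow_left₀ (abs_nonneg _) this 2
      _ = (D : ℝ) * R ^ 2 := by rw [Finset.sum_const, Finset.card_univ, Fintype.card_fin, nsmul_eq_mul]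
  have hs1 : (∑ μ, a μ ^ 2 + R ^ 2) + 1 ≤ ((D : ℝ) + 2) * R ^ 2 := by nlinarith
  have hpos : 0 < (∑ μ, a μ ^ 2 + R ^ 2) + 1 := by
    have := Finset.sum_nonneg fun μ (_ : μ ∈ Finset.univ) => sq_nonneg (a μ); linarith
  calc 4 / (((D : ℝ) + 2) ^ 3 * R ^ 4) = 4 * R ^ 2 / ((((D : ℝ) + 2) * R ^ 2) ^ 3) := by
        rw [div_eq_div_iff (by positivity) (by positivity)]; ring
    _ ≤ 4 * R ^ 2 / ((∑ μ, a μ ^ 2 + R ^ 2) + 1) ^ 3 := by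
        apply div_le_div_of_nonneg_left (by positivity) (by positivity)
        exact pow_le_pow_left₀ hpos.le hs1 3

end Algebra

/-! ## §2 Torus representatives -/

section Reps

variable {D : ℕ} (P : Fin D → ℕ)

/-- the `ν`-coordinate of `x + e_ν`. [folklore] -/
theorem add_unitVec_self (x : Tor P) (ν : Fin D) : (x + unitVec P ν) ν = x ν + 1 := by
  simp [unitVec]

/-- the other coordinates of `x + e_ν`. [folklore] -/
theorem add_unitVec_ne (x : Tor P) {ν μ : Fin D} (h : μ ≠ ν) : (x + unitVec P ν) μ = x μ := by
  simp [unitVec, h]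

/-- the `ν`-coordinate of `x − e_ν`. [folklore] -/
theorem sub_unitVec_self (x : Tor P) (ν : Fin D) : (x - unitVec P ν) ν = x ν - 1 := by
  simp [unitVec]

/-- the other coordinates of `x − e_ν`. [folklore] -/
theorem sub_unitVec_ne (x : Tor P) {ν μ : Fin D} (h : μ ≠ ν) : (x - unitVec P ν) μ = x μ := by
  simp [unitVec, h]

/-- away from the seam the centred representative of `z + 1` is `z̃ + 1`. [folklore] -/
theorem valMinAbs_add_one {n : ℕ} [NeZero n] (z : ZMod n) (h : 2 * |z.valMinAbs| + 2 < n) :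
    (z + 1).valMinAbs = z.valMinAbs + 1 := by
  rw [ZMod.valMinAbs_spec]
  refine ⟨by push_cast; simp, ?_, ?_⟩
  · have := neg_abs_le z.valMinAbs; linarith
  · have := le_abs_self z.valMinAbs; linarith

/-- away from the seam the centred representative of `z − 1` is `z̃ − 1`. [folklore] -/
theorem valMinAbs_sub_one {n : ℕ} [NeZero n] (z : ZMod n) (h : 2 * |z.valMinAbs| + 2 < n) :
    (z - 1).valMinAbs = z.valMinAbs - 1 := by
  rw [ZMod.valMinAbs_spec]
  refine ⟨by push_cast; simp, ?_, ?_⟩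
  · have := neg_abs_le z.valMinAbs; linarith
  · have := le_abs_self z.valMinAbs; linarith

/-- `valMinAbs 1 = 1` (`n ≥ 3`). [folklore] -/
theorem valMinAbs_one {n : ℕ} [NeZero n] (hn : 3 ≤ n) : (1 : ZMod n).valMinAbs = 1 := by
  have h := ZMod.valMinAbs_natCast_of_le_half (n := n) (a := 1) (by omega)
  simpa using h

/-- `valMinAbs (−1) = −1` (`n ≥ 3`). [folklore] -/
theorem valMinAbs_neg_one {n : ℕ} [NeZero n] (hn : 3 ≤ n) : (-1 : ZMod n).valMinAbs = -1 := by
  have h1 : (1 : ZMod n).val = 1 := ZMod.val_one'' (by omega)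
  rw [ZMod.valMinAbs_neg_of_ne_half (by rw [h1]; omega), valMinAbs_one hn]

/-- ALWAYS (`n ≥ 3`): `|valMinAbs (z+1)| ≥ |z̃| − 1`. [folklore] -/
theorem abs_valMinAbs_add_one_ge {n : ℕ} [NeZero n] (hn : 3 ≤ n) (z : ZMod n) :
    |z.valMinAbs| - 1 ≤ |(z + 1).valMinAbs| := by
  have h := ZMod.natAbs_valMinAbs_add_le (z + 1) (-1 : ZMod n)
  rw [add_neg_cancel_right, valMinAbs_neg_one hn] at h
  have h' : (z.valMinAbs.natAbs : ℤ) ≤ ((z + 1).valMinAbs + -1).natAbs := by exact_mod_cast h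
  rw [Int.natCast_natAbs, Int.natCast_natAbs] at h'
  have := abs_add_le (z + 1).valMinAbs (-1 : ℤ)
  rw [abs_neg, abs_one] at this
  linarith

/-- ALWAYS (`n ≥ 3`): `|valMinAbs (z−1)| ≥ |z̃| − 1`. [folklore] -/
theorem abs_valMinAbs_sub_one_ge {n : ℕ} [NeZero n] (hn : 3 ≤ n) (z : ZMod n) :
    |z.valMinAbs| - 1 ≤ |(z - 1).valMinAbs| := by
  have h := ZMod.natAbs_valMinAbs_add_le (z - 1) (1 : ZMod n)
  rw [sub_add_cancel, valMinAbs_one hn] at h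
  have h' : (z.valMinAbs.natAbs : ℤ) ≤ ((z - 1).valMinAbs + 1).natAbs := by exact_mod_cast h
  rw [Int.natCast_natAbs, Int.natCast_natAbs] at h'
  have := abs_add_le (z - 1).valMinAbs (1 : ℤ)
  rw [abs_one] at this
  linarith

/-- from `|b| ≥ |a| − 1` (reals): `b² ≥ a² − 2|a|`. [folklore] -/
theorem sq_ge_of_abs_ge {a b : ℝ} (h : |a| - 1 ≤ |b|) : a ^ 2 - 2 * |a| ≤ b ^ 2 := by
  rcases le_or_gt (|a|) 1 with h1 | h1
  · nlinarith [abs_nonneg a, sq_abs a, sq_nonneg b, abs_nonneg b]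
  · nlinarith [abs_nonneg a, sq_abs a, sq_abs b, abs_nonneg b]

/-- the sum of squared representatives of the neighbour `x + e_ν`: only the `ν`-term changes. [folklore] -/
theorem sum_sq_add_unitVec (x : Tor P) (ν : Fin D) :
    ∑ μ, (((x + unitVec P ν) μ).valMinAbs : ℝ) ^ 2
      = ∑ μ, ((x μ).valMinAbs : ℝ) ^ 2 - ((x ν).valMinAbs : ℝ) ^ 2 + ((x ν + 1).valMinAbs : ℝ) ^ 2 := by
  rw [← Finset.add_sum_erase _ _ (Finset.mem_univ ν), ← Finset.add_sum_erase _ (fun μ => ((x μ).valMinAbs : ℝ) ^ 2)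
    (Finset.mem_univ ν), add_unitVec_self]
  have : ∑ μ ∈ Finset.univ.erase ν, (((x + unitVec P ν) μ).valMinAbs : ℝ) ^ 2
      = ∑ μ ∈ Finset.univ.erase ν, ((x μ).valMinAbs : ℝ) ^ 2 :=
    Finset.sum_congr rfl fun μ hμ => by rw [add_unitVec_ne P x (Finset.ne_of_mem_erase hμ)]
  rw [this]
  ring

/-- the same for `x − e_ν`. [folklore] -/
theorem sum_sq_sub_unitVec (x : Tor P) (ν : Fin D) :
    ∑ μ, (((x - unitVec P ν) μ).valMinAbs : ℝ) ^ 2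
      = ∑ μ, ((x μ).valMinAbs : ℝ) ^ 2 - ((x ν).valMinAbs : ℝ) ^ 2 + ((x ν - 1).valMinAbs : ℝ) ^ 2 := by
  rw [← Finset.add_sum_erase _ _ (Finset.mem_univ ν), ← Finset.add_sum_erase _ (fun μ => ((x μ).valMinAbs : ℝ) ^ 2)
    (Finset.mem_univ ν), sub_unitVec_self]
  have : ∑ μ ∈ Finset.univ.erase ν, (((x - unitVec P ν) μ).valMinAbs : ℝ) ^ 2
      = ∑ μ ∈ Finset.univ.erase ν, ((x μ).valMinAbs : ℝ) ^ 2 :=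
    Finset.sum_congr rfl fun μ hμ => by rw [sub_unitVec_ne P x (Finset.ne_of_mem_erase hμ)]
  rw [this]
  ring

variable [hP : ∀ ν, NeZero (P ν)]

/-- ALWAYS: a neighbour's squared-representative sum is `≥ s − R² − 2|x̃_ν|`, up. [folklore] -/
theorem sum_sq_add_unitVec_ge (hP3 : ∀ ν, 3 ≤ P ν) (x : Tor P) (ν : Fin D) :
    ∑ μ, ((x μ).valMinAbs : ℝ) ^ 2 - 2 * |((x ν).valMinAbs : ℝ)|
      ≤ ∑ μ, (((x + unitVec P ν) μ).valMinAbs : ℝ) ^ 2 := by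
  rw [sum_sq_add_unitVec]
  have h : |((x ν).valMinAbs : ℝ)| - 1 ≤ |((x ν + 1).valMinAbs : ℝ)| := by
    have := abs_valMinAbs_add_one_ge (hP3 ν) (x ν)
    have h' : ((|(x ν).valMinAbs| - 1 : ℤ) : ℝ) ≤ ((|(x ν + 1).valMinAbs| : ℤ) : ℝ) := by exact_mod_cast this
    push_cast at h'
    exact h'
  have := sq_ge_of_abs_ge h
  linarith

/-- ALWAYS: the same, down. [folklore] -/
theorem sum_sq_sub_unitVec_ge (hP3 : ∀ ν, 3 ≤ P ν) (x : Tor P) (ν : Fin D) :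
    ∑ μ, ((x μ).valMinAbs : ℝ) ^ 2 - 2 * |((x ν).valMinAbs : ℝ)|
      ≤ ∑ μ, (((x - unitVec P ν) μ).valMinAbs : ℝ) ^ 2 := by
  rw [sum_sq_sub_unitVec]
  have h : |((x ν).valMinAbs : ℝ)| - 1 ≤ |((x ν - 1).valMinAbs : ℝ)| := by
    have := abs_valMinAbs_sub_one_ge (hP3 ν) (x ν)
    have h' : ((|(x ν).valMinAbs| - 1 : ℤ) : ℝ) ≤ ((|(x ν - 1).valMinAbs| : ℤ) : ℝ) := by exact_mod_cast this
    push_cast at h'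
    exact h'
  have := sq_ge_of_abs_ge h
  linarith

end Reps

end Summit.QuantumFields.BalabanUV.Beta.FP.TorusSupersolutionAlgebra
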